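import Summits.AtomisticToContinuum.Crystallization.Theorems.HullExactificationCascadeHullGoodEverywhereDefs
import HarnessLib

/-!
# The birth line partitions the crux without loss: `ZeroDefectDensity` implies both open stubs
# (route `HullExactificationCascade`, crux `ZeroDefectDensity`, stmt-AtomisticToContinuum-12086; line `registered`)

The skeleton proves `ZeroDefectDensity` from `stub_radialShellOrder` (radial order a.e.),
`stub_twoShellSpread` (landed, p146752) and `stub_orientationalOrder` (orientational order a.e. given
two-shell radial order).  This file records the CONVERSE direction, so that planners can read the
line as an equivalence: modulo the landed counting stub, the crux is exactly
"radial order a.e. ∧ orientational order a.e.".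

* `siteGood_radialTight` — pointwise: a `1/20`-good site is radially tight (its strict `13/10·d`
  shell is in bijection with a twelve-point pattern, and every rescaled shell point is within `1/20`
  of a unit vector, hence within `21/20·d` of the centre).  So `stub_radialShellOrder` is a
  CONSEQUENCE of the crux (no extra exposure), as the line card claims.
* `zeroDefectDensity_imp_stub_radialShellOrder`, `zeroDefectDensity_imp_stub_orientationalOrder`
  (registered sub-goals, verbatim the registered stub signatures behind `ZeroDefectDensity →`):
  both open stubs follow from the crux by the pointwise inclusions of defect sets and `squeeze_zero`.
-/

noncomputable section

namespace Summit.AtomisticToContinuum.Crystallization.Theorems.ZeroDefectDensityBirth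

open Literature.Geometry.DiscreteGeometry Filter Topology

/-- Monotonicity of subtype cardinalities on `Fin N`. [folklore] -/
theorem natCard_subtype_mono {N : ℕ} (P Q : Fin N → Prop) (h : ∀ i, P i → Q i) :
    Nat.card {i : Fin N // P i} ≤ Nat.card {i : Fin N // Q i} := by
  classical
  simp only [Nat.card_eq_fintype_card, Fintype.card_subtype]
  exact Finset.card_le_card fun i hi => by
    simp only [Finset.mem_filter, Finset.mem_univ, true_and] at hi ⊢
    exact h i hi

/-- Density form: if the `Q`-sites have density `→ 0` and `P ⊆ Q` pointwise, the `P`-sites have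
density `→ 0`. [folklore] -/
theorem tendsto_density_mono {P Q : ∀ N : ℕ, Fin N → Prop} (h : ∀ N i, P N i → Q N i)
    (hQ : Tendsto (fun N : ℕ => (Nat.card {i : Fin N // Q N i} : ℝ) / (N : ℝ)) atTop (nhds 0)) :
    Tendsto (fun N : ℕ => (Nat.card {i : Fin N // P N i} : ℝ) / (N : ℝ)) atTop (nhds 0) := by
  refine squeeze_zero (fun N => by positivity) (fun N => ?_) hQ
  exact div_le_div_of_nonneg_right (by exact_mod_cast natCard_subtype_mono _ _ (h N))
    (Nat.cast_nonneg N)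

/-- **A good site is radially tight (pointwise).** If the strict `13/10·d`-shell of `y` in `S`
(`d = dist(y, S ∖ {y})`) is `1/20`-matched, through a bijection and a linear isometry, to the fcc or
the hcp kissing pattern, then it has exactly twelve points and all of them lie within `21/20·d` of
`y`. [folklore] -/
theorem siteGood_radialTight {S : Set (EuclideanSpace ℝ (Fin 3))} {y : EuclideanSpace ℝ (Fin 3)}
    (h : SiteGood S y) :
    Nat.card ↥{w : EuclideanSpace ℝ (Fin 3) | w ∈ S ∧ w ≠ y ∧
        dist w y < 13 / 10 * sInf ((fun w => dist w y) '' (S \ {y}))} = 12 ∧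
      ∀ w ∈ {w : EuclideanSpace ℝ (Fin 3) | w ∈ S ∧ w ≠ y ∧
        dist w y < 13 / 10 * sInf ((fun w => dist w y) '' (S \ {y}))},
        dist w y ≤ 21 / 20 * sInf ((fun w => dist w y) '' (S \ {y})) := by
  simp only [SiteGood] at h
  obtain ⟨A, hA⟩ := h
  -- a uniform treatment of the two patterns
  have key : ∀ (P : Finset (EuclideanSpace ℝ (Fin 3))), P.card = 12 → (∀ v ∈ P, ‖v‖ = 1) →
      (∃ e : ↥{w : EuclideanSpace ℝ (Fin 3) | w ∈ S ∧ w ≠ y ∧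
          dist w y < 13 / 10 * sInf ((fun w => dist w y) '' (S \ {y}))} ≃ ↥P,
        ∀ t : ↥{w : EuclideanSpace ℝ (Fin 3) | w ∈ S ∧ w ≠ y ∧
          dist w y < 13 / 10 * sInf ((fun w => dist w y) '' (S \ {y}))},
          dist ((sInf ((fun w => dist w y) '' (S \ {y})))⁻¹ •
          ((t : EuclideanSpace ℝ (Fin 3)) - y)) (A ((e t : ↥P) : EuclideanSpace ℝ (Fin 3))) ≤
            1 / 20) →
      Nat.card ↥{w : EuclideanSpace ℝ (Fin 3) | w ∈ S ∧ w ≠ y ∧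
          dist w y < 13 / 10 * sInf ((fun w => dist w y) '' (S \ {y}))} = 12 ∧
        ∀ w ∈ {w : EuclideanSpace ℝ (Fin 3) | w ∈ S ∧ w ≠ y ∧
          dist w y < 13 / 10 * sInf ((fun w => dist w y) '' (S \ {y}))},
          dist w y ≤ 21 / 20 * sInf ((fun w => dist w y) '' (S \ {y})) := by
    intro P hP hP1 ⟨e, he⟩
    have hcard : Nat.card ↥{w : EuclideanSpace ℝ (Fin 3) | w ∈ S ∧ w ≠ y ∧
        dist w y < 13 / 10 * sInf ((fun w => dist w y) '' (S \ {y}))} = 12 := by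
      rw [Nat.card_congr e, Nat.card_eq_fintype_card, Fintype.card_coe, hP]
    refine ⟨hcard, ?_⟩
    intro w hw
    have hd0 : 0 ≤ sInf ((fun w => dist w y) '' (S \ {y})) := by
      apply Real.sInf_nonneg
      rintro _ ⟨z, -, rfl⟩
      exact dist_nonneg
    rcases hd0.lt_or_eq with hdpos | hd0'
    · have ht := he ⟨w, hw⟩
      change dist ((sInf ((fun w => dist w y) '' (S \ {y})))⁻¹ • (w - y))
        (A ((e ⟨w, hw⟩ : ↥P) : EuclideanSpace ℝ (Fin 3))) ≤ 1 / 20 at ht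
      have hnorm : ‖A ((e ⟨w, hw⟩ : ↥P) : EuclideanSpace ℝ (Fin 3))‖ = 1 := by
        rw [LinearIsometry.norm_map]
        exact hP1 _ (e ⟨w, hw⟩).2
      have hsub := norm_sub_norm_le ((sInf ((fun w => dist w y) '' (S \ {y})))⁻¹ • (w - y))
        (A ((e ⟨w, hw⟩ : ↥P) : EuclideanSpace ℝ (Fin 3)))
      rw [← dist_eq_norm, hnorm] at hsub
      have h1 : ‖(sInf ((fun w => dist w y) '' (S \ {y})))⁻¹ • (w - y)‖ ≤ 1 + 1 / 20 := by
        linarith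
      rw [norm_smul, norm_inv, Real.norm_of_nonneg hdpos.le, ← dist_eq_norm,
        inv_mul_le_iff₀ hdpos] at h1
      linarith
    · -- degenerate scale `d = 0`: the shell is empty, contradicting the bijection with 12 points
      exfalso
      have hempty : {w : EuclideanSpace ℝ (Fin 3) | w ∈ S ∧ w ≠ y ∧
          dist w y < 13 / 10 * sInf ((fun w => dist w y) '' (S \ {y}))} = ∅ := by
        ext z
        simp only [Set.mem_setOf_eq, Set.mem_empty_iff_false, iff_false, not_and, not_lt]
        intro _ _
        rw [← hd0']
        simp
      rw [hempty] at hcard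
      simp at hcard
  rcases hA with h | h
  · exact key fccKissingPattern card_fccKissingPattern
      (fun v hv => norm_eq_one_of_mem_fccKissingPattern hv) h
  · exact key hcpKissingPattern card_hcpKissingPattern
      (fun v hv => norm_eq_one_of_mem_hcpKissingPattern hv) h

/-- **The crux implies stub 1** (registered sub-goal; the stub signature verbatim behind
`ZeroDefectDensity →`): radial shell order a.e. follows from zero defect density, because a site
that is not radially tight is not good (`siteGood_radialTight`). [folklore] -/
theorem zeroDefectDensity_imp_stub_radialShellOrder : Summit.AtomisticToContinuum.Crystallization.Theses.HullExactificationCascade.ZeroDefectDensity → ∀ (x : (N : ℕ) → (Fin N → EuclideanSpace ℝ (Fin 3))), (∀ N, Literature.MathematicalPhysics.StatisticalMechanics.IsGroundState Literature.MathematicalPhysics.StatisticalMechanics.lennardJones (x N)) → Filter.Tendsto (fun N : ℕ => (Nat.card {i : Fin N // ¬ (Nat.card ↥{w : EuclideanSpace ℝ (Fin 3) | w ∈ Set.range (x N) ∧ w ≠ (x N i) ∧ dist w (x N i) < 13 / 10 * sInf ((fun w => dist w (x N i)) '' (Set.range (x N) \ {(x N i)}))} = 12 ∧ ∀ w ∈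 {w : EuclideanSpace ℝ (Fin 3) | w ∈ Set.range (x N) ∧ w ≠ (x N i) ∧ dist w (x N i) < 13 / 10 * sInf ((fun w => dist w (x N i)) '' (Set.range (x N) \ {(x N i)}))}, dist w (x N i) ≤ 21 / 20 * sInf ((fun w => dist w (x N i)) '' (Set.range (x N) \ {(x N i)})))} : ℝ) / (N : ℝ)) Filter.atTop (nhds (0 : ℝ)) := by
  intro hZ x hx
  have hQ : Tendsto (fun N : ℕ =>
      (Nat.card {i : Fin N // ¬ SiteGood (Set.range (x N)) (x N i)} : ℝ) / (N : ℝ))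
      atTop (nhds 0) := hZ x hx
  refine tendsto_density_mono ?_ hQ
  intro N i hi hg
  exact hi (siteGood_radialTight hg)

/-- **The crux implies stub 3** (registered sub-goal; the stub signature verbatim behind
`ZeroDefectDensity →`): the two-shell-tight-but-not-good sites are among the not-good sites.
[folklore] -/
theorem zeroDefectDensity_imp_stub_orientationalOrder : Summit.AtomisticToContinuum.Crystallization.Theses.HullExactificationCascade.ZeroDefectDensity → ∀ (x : (N : ℕ) → (Fin N → EuclideanSpace ℝ (Fin 3))), (∀ N, Literature.MathematicalPhysics.StatisticalMechanics.IsGroundState Literature.MathematicalPhysics.StatisticalMechanics.lennardJones (x N)) → Filter.Tendsto (fun N : ℕ => (Nat.card {i : Fin N // ((Nat.card ↥{w : EuclideanSpace ℝ (Fin 3) | w ∈ Set.range (x N) ∧ w ≠ (x N i) ∧ dist w (x N i) < 13 / 10 * sInf ((fun w => dist w (x N i)) '' (Set.range (x N) \ {(x N i)}))} = 12 ∧ ∀ w ∈ {w : EuclideanSpace ℝ (Fin 3) | w ∈ Set.range (x N) ∧ w ≠ (x N i) ∧ dist w (x N i) < 13 / 10 * sInf ((fun w => dist w (x N i)) ''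 (Set.range (x N) \ {(x N i)}))}, dist w (x N i) ≤ 21 / 20 * sInf ((fun w => dist w (x N i)) '' (Set.range (x N) \ {(x N i)}))) ∧ ∀ z ∈ Set.range (x N), dist z (x N i) < 13 / 5 * sInf ((fun w => dist w (x N i)) '' (Set.range (x N) \ {(x N i)})) → (Nat.card ↥{w : EuclideanSpace ℝ (Fin 3) | w ∈ Set.range (x N) ∧ w ≠ z ∧ dist w z < 13 / 10 * sInf ((fun w => dist w z) '' (Set.range (x N) \ {z}))} = 12 ∧ ∀ w ∈ {w : EuclideanSpace ℝ (Fin 3) | w ∈ Set.range (x N) ∧ w ≠ z ∧ dist w z < 13 / 10 * sInf ((fun w => dist w z) '' (Set.range (x N) \ {z}))}, dist w z ≤ 21 / 20 * sInf ((fun w => dist w z) '' (Set.range (x N) \ {z})))) ∧ ¬ Summit.AtomisticToContinuum.Crystallization.Theorems.SiteGood (Set.range (x N)) (x N i)} : ℝ) / (N : ℝ)) Filter.atTop (nhds (0 : ℝ)) := by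
  intro hZ x hx
  have hQ : Tendsto (fun N : ℕ =>
      (Nat.card {i : Fin N // ¬ SiteGood (Set.range (x N)) (x N i)} : ℝ) / (N : ℝ))
      atTop (nhds 0) := hZ x hx
  refine tendsto_density_mono ?_ hQ
  intro N i hi
  exact hi.2

end Summit.AtomisticToContinuum.Crystallization.Theorems.ZeroDefectDensityBirth

end
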